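import Summits.CriticalPhenomena.SAWScalingLimit.Theorems.FKGToTraversalBound.Negative.R1Split
import Literature.Barriers.CriticalPhenomena.SAPAnisotropicNotDFinite

/-!
# Sketch — crux-ideate round 2, ideator 5, crux `FKGToTraversalBound` (stmt-CriticalPhenomena-1878)

First-lemma signatures for the idea card `pushdown-polygon-bubble` (engine bottleneck) and the
plumbing lemma `EventualShellReduction` (per-shell EVENTUAL form of (H1)).  Statements only
(`def … : Prop`), no `sorry`; everything over existing declarations.
-/

noncomputable section

open MeasureTheory Set Filter Topology
open scoped ENNReal
open Literature.Probability.LatticeModels Literature.Probability.RandomPlanarGeometry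
open Summit.CriticalPhenomena.SAWScalingLimit.Theses.SAWLeftRightFKG
open Summit.CriticalPhenomena.SAWScalingLimit.Theorems.FKGToTraversalBound.Negative

namespace Summit.CriticalPhenomena.SAWScalingLimit.Cruxes.FKGToTraversalBound.Ideator5

/-! ## A. The engine bottleneck is the critical polygon sum -/

/-- `CeilingBubbleBound`, verbatim from the lead's workfile `EngineNeedsBubble.lean` (F-B): an absolute bound on
the `x_c`-mass of chords between the adjacent ceiling sites `(0,0) ∼ (1,0)` of any r2 carrier lying in the closed
lower half-plane. -/
def CeilingBubbleBound : Prop :=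
  ∃ K : ℝ≥0∞, K ≠ ⊤ ∧ ∀ (c : Site 2) (C : (zdGraph 2).Walk c c),
    (∀ p ∈ meshDomain (dom C 1) 1, p 1 ≤ 0) →
      SAW.weight (dom C 1) 1 ![0, 0] ![1, 0] Set.univ ≤ K

open Classical in
/-- **Top-rooted chord count** `t_n`: `n`-step SAWs of `ℤ²` from `0` to `e₁ = (1,0)` with every vertex in the
closed lower half-plane `{y ≤ 0}`.  Closing with the edge `(e₁,0)`: the `(n+1)`-gons through the edge `{0,e₁}`
whose TOP row is `0`; a polygon shape `P` is counted `t(P) = #(top-row edges of P) ≥ 1` times. -/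
def topChordCount (n : ℕ) : ℕ :=
  (((zdGraph 2).finsetWalkLength n (0 : Site 2) ![1, 0]).filter
    fun p => p.IsPath ∧ ∀ v ∈ p.support, v 1 ≤ 0).card

open Classical in
/-- **Sunk chord count** `s_n`: as `topChordCount` but every INTERMEDIATE vertex strictly below row `0`.
Closing with `{0,e₁}`: the `(n+1)`-gon shapes with a UNIQUE top edge, each counted once, so
`s_n ≤ q_{n+1} ≤ t_n` (`q_N = Literature.Barriers.CriticalPhenomena.isotropicPolygonCount N`). -/
def sunkChordCount (n : ℕ) : ℕ :=
  (((zdGraph 2).finsetWalkLength n (0 : Site 2) ![1, 0]).filter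
    fun p => p.IsPath ∧ ∀ v ∈ p.support, v ≠ 0 → v ≠ ![1, 0] → v 1 ≤ -1).card

/-- **The push-down shift** (the surgery of Madras–Slade Thm 3.2.3, eq. (3.2.3), applied at the rooted top edge
instead of the lexicographic extreme point): `ω ↦ (0 → -e₂) · (ω - e₂) · (e₁ - e₂ → e₁)` is an injection from
top-rooted `n`-chords to sunk `(n+2)`-chords (the shifted copy lies in `{y ≤ -1}`, the two new sites are free).
Hence `t_n ≤ s_{n+2} ≤ q_{n+3}`: ROOTING A POLYGON AT A BOUNDARY EDGE COSTS A FACTOR `μ²`, NOT `n`. -/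
def TopChordShift : Prop := ∀ n : ℕ, topChordCount n ≤ sunkChordCount (n + 2)

/-- Sunk chords close into polygon shapes with a unique top edge: `s_n ≤ q_{n+1}`. -/
def SunkLePolygon : Prop :=
  ∀ n : ℕ, sunkChordCount n ≤ Literature.Barriers.CriticalPhenomena.isotropicPolygonCount (n + 1)

/-- Every polygon shape has at least one top edge: `q_{n+1} ≤ t_n`. -/
def PolygonLeTopChord : Prop :=
  ∀ n : ℕ, Literature.Barriers.CriticalPhenomena.isotropicPolygonCount (n + 1) ≤ topChordCount n

/-- **C⁺ (the transferred bottleneck): the critical polygon generating function is finite**,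
`Q(x_c) = Σ_N q_N x_c^N < ∞` on `ℤ²` (Madras–Slade 1993 §8.1, eq. (8.1.8): expected finite in all dimensions,
proved only in the weaker sense `Q(z) = O((z_c - z)^{-1/2})` for `d = 2`; Hammond 2018 Thm 1.3: `q_N μ^{-N} ≤
N^{-3/2+o(1)}` on a density-one set of even `N`). -/
def PolygonSumFinite : Prop :=
  Summable fun N : ℕ =>
    (Literature.Barriers.CriticalPhenomena.isotropicPolygonCount N : ℝ) * SAW.criticalFugacity ^ N

/-- The same statement over the top-rooted counts (equivalent to `PolygonSumFinite` by `TopChordShift`,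
`SunkLePolygon`, `PolygonLeTopChord`: the two series dominate each other up to the factor `x_c^{-3}`). -/
def TopChordSumFinite : Prop :=
  Summable fun n : ℕ => (topChordCount n : ℝ) * SAW.criticalFugacity ^ n

/-- **First lemma of the line (engine side).**  The chords of a lower-half-plane carrier between `(0,0)` and
`(1,0)` inject, length-preservingly, into top-rooted chords (`discreteDomainGraph ≤ zdGraph 2`), so
`weight univ ≤ Σ_n t_n x_c^n`; with the shift, `CeilingBubbleBound` follows from `PolygonSumFinite` with
`K = x_c^{-3} Q(x_c)`. -/
def CeilingBubbleOfPolygonSum : Prop := PolygonSumFinite → CeilingBubbleBound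

/-- Converse (exhaustion of the lower half-plane by box rooms): the bottleneck IS the polygon sum. -/
def PolygonSumOfCeilingBubble : Prop := CeilingBubbleBound → PolygonSumFinite

/-! ## B. Plumbing: (H1) is a per-shell EVENTUAL statement -/

/-- Per-shell eventual bound at the `(ρ/R)³`-quantile: for every FIXED shell some threshold `n` works for all
sufficiently small meshes (no `δ₀` uniform in the shell, no rate). -/
def EventualShellBound (D : DobrushinDomain) (a b : ℝ → Site 2) : Prop :=
  ∀ (x : ℂ) (ρ R : ℝ), 0 < ρ → ρ < R → R ≤ 1 → ∃ n : ℕ, ∀ᶠ δ in 𝓝[>] (0 : ℝ),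
    SAW.law D.carrier δ (a δ) (b δ)
        {γ | (⟨γ.walk.toCurve (meshPoint δ)⟩ : Curve ℂ).HasTraversals n x ρ R} ≤
      ENNReal.ofReal (8 * (ρ / R) ^ (3 : ℕ))

/-- Deterministic count: a traversal of `D(x;ρ,R)` by a lattice polyline starts on some edge, and a straight
edge meets the closed annulus in at most two segments, so at most two traversals start on each edge:
`k ≤ 2 |γ|` (and `|γ| ≤ #(lattice sites of Ω_δ) ≤ (diam Ω/δ + 1)²`). -/
def TraversalCountBound : Prop :=
  ∀ (Ω : Set ℂ) (δ : ℝ) (a b : Site 2) (γ : SAW.DomainSAW Ω δ a b) (x : ℂ) (ρ R : ℝ) (k : ℕ),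
    0 < δ → ρ < R →
      (⟨γ.walk.toCurve (meshPoint δ)⟩ : Curve ℂ).HasTraversals k x ρ R → k ≤ 2 * γ.length

/-- **Eventual-shell reduction** (provable now from `TraversalCountBound`, `HasTraversals.of_le`,
`law ≤ 1`): with `K = 8`, `λ = 3`, `δ₀ = 1` and `k(x,ρ,R) := max n (2 (diam D/δ₁ + 2)² + 1)`, where `(n, δ₁)`
witness `EventualShellBound` at that shell, meshes `δ < δ₁` are covered by the eventual bound and meshes
`δ ∈ [δ₁, ρ]` by emptiness of the event.  So (H1) — for deep and boundary approximations alike — is needed one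
fixed shell at a time, only asymptotically in `δ`. -/
def EventualShellReduction : Prop :=
  ∀ (D : DobrushinDomain) (a b : ℝ → Site 2), SAW.IsEndpointApprox D a b → EventualShellBound D a b → H1At D a b

/-- and conversely nothing is lost up to constants: (H1) gives the eventual bound with `K (ρ/R)^λ` in place of
`8 (ρ/R)³` (recorded to make clear the reduction is an equivalence of SHAPES, not of constants). -/
def H1AtEventually (D : DobrushinDomain) (a b : ℝ → Site 2) : Prop :=
  ∃ (k : ℂ → ℝ → ℝ → ℕ) (K lam : ℝ), 0 ≤ K ∧ 2 < lam ∧ ∀ (x : ℂ) (ρ R : ℝ), 0 < ρ → ρ < R → R ≤ 1 →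
    ∀ᶠ δ in 𝓝[>] (0 : ℝ), SAW.law D.carrier δ (a δ) (b δ)
        {γ | (⟨γ.walk.toCurve (meshPoint δ)⟩ : Curve ℂ).HasTraversals (k x ρ R) x ρ R} ≤
      ENNReal.ofReal (K * (ρ / R) ^ lam)

theorem h1AtEventually_of_H1At (D : DobrushinDomain) (a b : ℝ → Site 2) (h : H1At D a b) :
    H1AtEventually D a b := by
  obtain ⟨k, K, lam, δ₀, hK, hlam, hδ₀, h⟩ := h
  refine ⟨k, K, lam, hK, hlam, fun x ρ R hρ hρR hR => ?_⟩
  have hmem : Set.Ioo (0 : ℝ) (min δ₀ ρ) ∈ 𝓝[>] (0 : ℝ) := Ioo_mem_nhdsGT (lt_min hδ₀ hρ)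
  filter_upwards [hmem] with δ hδ
  exact h δ ⟨hδ.1, hδ.2.le.trans (min_le_left _ _)⟩ x ρ R (hδ.2.le.trans (min_le_right _ _)) hρR hR

end Summit.CriticalPhenomena.SAWScalingLimit.Cruxes.FKGToTraversalBound.Ideator5

end
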